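import Mathlib
import Summits.NavierStokesRegularity.NavierStokesRegularity.Theorems.WakeRatchetTailRatchetBlockDSSFloor
import HarnessLib

/-!
# `WakeRatchet.TailRatchet` (stmt-NavierStokesRegularity-21808): the SHARP amplitude floor — EVERY
# non-trivial uniformly bounded admissible eternal solution of a comparable table (any covariant
# viscosity, self-similar or not) has type-I constant `> 1/(896 ε₀)`

Support file for the crux `TailRatchet` (route `WakeRatchet`; MODEL lattice ODEs of Tao 2016 §4 —
nothing in this file is a statement about the Navier–Stokes equations, and no item is closed here).

This file removes the self-similarity hypothesis from the `ε₀⁻¹` floor of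
`WakeRatchetTailRatchetBlockDSSFloor` and sharpens the `ε₀`-uniform gap `1/576` of
`WakeRatchetTailRatchetEternalGapVisc`.  For a bounded admissible eternal solution (`IsEternalVisc ε₀ ν̂ α W`,
any `ν̂ ≥ 0`, `‖W_n(σ)‖ ≤ C`, cancelling table, `ε₀ > 0`) put `J_n = ∫‖W_n‖²`, `I_n = ∫⟪W_{n+1}, A W_n⟫`,
`f = fluxConst α`, `θ = (Λ − Λ⁻¹)·f·C`.  The shell balance `J_n ≤ Λ I_{n−1} − Λ⁻¹ I_n`
(tree `integral_norm_sq_le`) summed over a block gives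
`Σ_{k<N} J_{a+k} ≤ (Λ−Λ⁻¹) Σ_{k<N} I_{a+k} + Λ (I_{a−1} − I_{a+N−1})` (`block_le`), hence for `θ < 1`
uniformly bounded block sums and SUMMABILITY of `n ↦ J_n` over `ℤ` (`summable_action_sq`), hence of
`n ↦ I_n` (`|I_n| ≤ f C J_n`).  Summing the shell balance over ALL of `ℤ` the boundary terms are gone
(shift invariance of `Σ'`): `Σ' J ≤ (Λ − Λ⁻¹) Σ' I ≤ θ Σ' J`, so `Σ' J = 0`:

* `eq_zero_of_small_bound_sharp` — `(Λ − Λ⁻¹)·fluxConst α·C < 1 ⇒ W ≡ 0` (any `ν̂ ≥ 0`);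
* `eternal_exists_large` — on a cancelling `R`-comparable table (`m = 4`), `0 < ε₀ ≤ 1`: every
  non-trivial uniformly bounded admissible eternal solution has `‖W_n(σ)‖ > 1/(896 ε₀)` somewhere;
* `tailRatchet_scope_floor` — the same with the crux's hypotheses `InTableClass R α`, `IsEternalVisc`.

READING FOR THE CENSUS of stmt-21808 / 25584 / 25646 / 25647 / 20420: the entire hypothesis class of
the tail ratchets consists of the zero solution and of LARGE solutions, type-I constant
`sup_n,σ ‖W_n(σ)‖ = sup Λⁿ(t⋆−t)‖X_n(t)‖ > 1/(896 ε₀) → ∞` as the scale ratio becomes fine; any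
renormalised blow-up limit (K2-type extraction) on a comparable table is trivial or that large.

HONEST FRAMING: elementary real analysis on the cell's lemma layer; MODEL lattice only.
-/

noncomputable section

set_option linter.dupNamespace false

namespace Summit.NavierStokesRegularity.NavierStokesRegularity.Theorems

namespace WakeRatchetEternalFloor

open MeasureTheory Set Filter Topology
open scoped RealInnerProductSpace
open Literature.Analysis.FluidPDE Literature.Analysis.FluidPDE.TaoCascade
open WakeRatchetEternalActionSummable WakeRatchetEternalGapVisc WakeRatchetBlockDSSFloor

variable {m : ℕ} {ε₀ νh : ℝ} {α : Fin m → Fin m → Fin m → ℤ × ℤ × ℤ → ℝ} {W : ℤ → ℝ → Em m}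

/-- **Block inequality, any viscosity.**  `Σ_{k<N} ∫‖W_{a+k}‖² ≤ (Λ−Λ⁻¹)·Σ_{k<N} I_{a+k} + Λ·(I_{a−1} − I_{a+N−1})`
with `I_n = ∫⟪W_{n+1}, A W_n⟫`. [cite: Tao2016AveragedNS, §4 (4.1)–(4.3), Lemma 4.1 (4.9)–(4.10), §6.4; cell theorem] -/
theorem block_le (hε : 0 < ε₀) (hW : IsEternalVisc ε₀ νh α W) (hc : IsCancellingCoeff α) {C : ℝ}
    (hC : ∀ k σ, ‖W k σ‖ ≤ C) (a : ℤ) (N : ℕ) :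
    ∑ k ∈ Finset.range N, (∫ σ, ‖W (a + k) σ‖ ^ 2)
      ≤ (bigLam ε₀ - (bigLam ε₀)⁻¹) *
          ∑ k ∈ Finset.range N, (∫ σ, ⟪W (a + k + 1) σ, tableA α (W (a + k) σ)⟫)
        + bigLam ε₀ * ((∫ σ, ⟪W (a - 1 + 1) σ, tableA α (W (a - 1) σ)⟫)
          - (∫ σ, ⟪W (a + N - 1 + 1) σ, tableA α (W (a + N - 1) σ)⟫)) := by
  set I : ℤ → ℝ := fun n => ∫ σ, ⟪W (n + 1) σ, tableA α (W n σ)⟫ with hI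
  have hbal : ∀ n : ℤ, ∫ σ, ‖W n σ‖ ^ 2 ≤ bigLam ε₀ * I (n - 1) - (bigLam ε₀)⁻¹ * I n := by
    intro n
    have h := integral_norm_sq_le hε hW hc hC n
    simp only [hI, sub_add_cancel]
    exact h
  have h1 : ∑ k ∈ Finset.range N, ∫ σ, ‖W (a + k) σ‖ ^ 2
      ≤ bigLam ε₀ * ∑ k ∈ Finset.range N, I (a - 1 + k)
        - (bigLam ε₀)⁻¹ * ∑ k ∈ Finset.range N, I (a + k) := by
    rw [Finset.mul_sum, Finset.mul_sum, ← Finset.sum_sub_distrib]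
    refine Finset.sum_le_sum fun k _ => ?_
    have h := hbal (a + k)
    rw [show a + (k : ℤ) - 1 = a - 1 + k by ring] at h
    exact h
  rw [sum_shift_pred I a N] at h1
  show ∑ k ∈ Finset.range N, ∫ σ, ‖W (a + k) σ‖ ^ 2
      ≤ (bigLam ε₀ - (bigLam ε₀)⁻¹) * ∑ k ∈ Finset.range N, I (a + k)
        + bigLam ε₀ * (I (a - 1) - I (a + N - 1))
  linarith

/-- Uniform bound on block sums when `θ = (Λ−Λ⁻¹)·fluxConst α·C < 1` (any viscosity).
[cite: Tao2016AveragedNS, §4 (4.1)–(4.3), Lemma 4.1 (4.8)–(4.10), §6.4; cell theorem] -/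
theorem block_sum_le_const (hε : 0 < ε₀) (hW : IsEternalVisc ε₀ νh α W) (hc : IsCancellingCoeff α)
    {C : ℝ} (hC : ∀ k σ, ‖W k σ‖ ≤ C)
    (hθ : (bigLam ε₀ - (bigLam ε₀)⁻¹) * fluxConst α * C < 1) :
    ∃ K : ℝ, ∀ (a : ℤ) (N : ℕ), ∑ k ∈ Finset.range N, ∫ σ, ‖W (a + k) σ‖ ^ 2 ≤ K := by
  obtain ⟨M, hM⟩ := hW.action
  set I : ℤ → ℝ := fun n => ∫ σ, ⟪W (n + 1) σ, tableA α (W n σ)⟫ with hI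
  set J : ℤ → ℝ := fun n => ∫ σ, ‖W n σ‖ ^ 2 with hJ
  have hΛ1 : 1 ≤ bigLam ε₀ := one_le_bigLam hε.le
  have hΛ0 : 0 ≤ bigLam ε₀ := by linarith
  have hC0 : 0 ≤ C := (norm_nonneg _).trans (hC 0 0)
  have hf0 : 0 ≤ fluxConst α := (table_sTable α hc).CA_nonneg
  have hfC : 0 ≤ fluxConst α * C := mul_nonneg hf0 hC0
  have hnn : 0 ≤ bigLam ε₀ - (bigLam ε₀)⁻¹ := by
    have : (bigLam ε₀)⁻¹ ≤ 1 := inv_le_one_of_one_le₀ hΛ1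
    linarith
  have hJ0 : ∀ n, 0 ≤ J n := fun n => integral_nonneg fun σ => by positivity
  have hIJ : ∀ n : ℤ, |I n| ≤ fluxConst α * C * J n := fun n => abs_integral_flux_le_visc hW hc hC n
  have hJB : ∀ n : ℤ, J n ≤ C * M := by
    intro n
    calc ∫ σ, ‖W n σ‖ ^ 2 ≤ ∫ σ, C * ‖W n σ‖ := by
          refine integral_mono (integrable_norm_sq_visc hW hC n) ((hM n).1.const_mul C) fun σ => ?_
          simp only [sq]
          exact mul_le_mul_of_nonneg_right (hC n σ) (norm_nonneg _)
      _ = C * ∫ σ, ‖W n σ‖ := integral_const_mul _ _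
      _ ≤ C * M := mul_le_mul_of_nonneg_left (hM n).2 hC0
  refine ⟨bigLam ε₀ * fluxConst α * C * (C * M + C * M) /
      (1 - (bigLam ε₀ - (bigLam ε₀)⁻¹) * fluxConst α * C), fun a N => ?_⟩
  have hblock := block_le hε hW hc hC a N
  -- bound the flux sums by the action sums
  have hIsum : |∑ k ∈ Finset.range N, I (a + k)| ≤ fluxConst α * C * ∑ k ∈ Finset.range N, J (a + k) := by
    calc |∑ k ∈ Finset.range N, I (a + k)| ≤ ∑ k ∈ Finset.range N, |I (a + k)| :=
          Finset.abs_sum_le_sum_abs _ _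
      _ ≤ ∑ k ∈ Finset.range N, fluxConst α * C * J (a + k) :=
          Finset.sum_le_sum fun k _ => hIJ (a + k)
      _ = fluxConst α * C * ∑ k ∈ Finset.range N, J (a + k) := by rw [Finset.mul_sum]
  have hb1 : (bigLam ε₀ - (bigLam ε₀)⁻¹) * ∑ k ∈ Finset.range N, I (a + k)
      ≤ (bigLam ε₀ - (bigLam ε₀)⁻¹) * (fluxConst α * C * ∑ k ∈ Finset.range N, J (a + k)) :=
    mul_le_mul_of_nonneg_left ((le_abs_self _).trans hIsum) hnn
  have hb2 : bigLam ε₀ * (I (a - 1) - I (a + N - 1))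
      ≤ bigLam ε₀ * (fluxConst α * C * J (a - 1) + fluxConst α * C * J (a + N - 1)) := by
    refine mul_le_mul_of_nonneg_left ?_ hΛ0
    have h1 := (le_abs_self _).trans (hIJ (a - 1))
    have h2 := (neg_le_abs _).trans (hIJ (a + N - 1))
    linarith
  replace hblock : ∑ k ∈ Finset.range N, J (a + k)
      ≤ (bigLam ε₀ - (bigLam ε₀)⁻¹) * ∑ k ∈ Finset.range N, I (a + k)
        + bigLam ε₀ * (I (a - 1) - I (a + N - 1)) := hblock
  have key : ∑ k ∈ Finset.range N, J (a + k)
      ≤ (bigLam ε₀ - (bigLam ε₀)⁻¹) * fluxConst α * C * ∑ k ∈ Finset.range N, J (a + k)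
        + bigLam ε₀ * fluxConst α * C * (J (a - 1) + J (a + N - 1)) := by
    calc ∑ k ∈ Finset.range N, J (a + k)
        ≤ (bigLam ε₀ - (bigLam ε₀)⁻¹) * ∑ k ∈ Finset.range N, I (a + k)
          + bigLam ε₀ * (I (a - 1) - I (a + N - 1)) := hblock
      _ ≤ (bigLam ε₀ - (bigLam ε₀)⁻¹) * (fluxConst α * C * ∑ k ∈ Finset.range N, J (a + k))
          + bigLam ε₀ * (fluxConst α * C * J (a - 1) + fluxConst α * C * J (a + N - 1)) :=
          add_le_add hb1 hb2
      _ = (bigLam ε₀ - (bigLam ε₀)⁻¹) * fluxConst α * C * ∑ k ∈ Finset.range N, J (a + k)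
          + bigLam ε₀ * fluxConst α * C * (J (a - 1) + J (a + N - 1)) := by ring
  have hK0 : 0 ≤ bigLam ε₀ * fluxConst α * C := by positivity
  have hJJ : J (a - 1) + J (a + N - 1) ≤ C * M + C * M := add_le_add (hJB _) (hJB _)
  rw [le_div_iff₀ (by linarith)]
  have e : (∑ k ∈ Finset.range N, J (a + ↑k)) * (1 - (bigLam ε₀ - (bigLam ε₀)⁻¹) * fluxConst α * C)
      = (∑ k ∈ Finset.range N, J (a + ↑k))
        - (bigLam ε₀ - (bigLam ε₀)⁻¹) * fluxConst α * C * ∑ k ∈ Finset.range N, J (a + k) := by ring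
  show (∑ k ∈ Finset.range N, J (a + ↑k)) * (1 - (bigLam ε₀ - (bigLam ε₀)⁻¹) * fluxConst α * C)
      ≤ bigLam ε₀ * fluxConst α * C * (C * M + C * M)
  rw [e]
  nlinarith [mul_le_mul_of_nonneg_left hJJ hK0]

/-- **Summable shell actions under `θ < 1`, any viscosity.** [cite: Tao2016AveragedNS, §4 (4.1)–(4.3), Lemma 4.1 (4.8)–(4.10), §6.4; cell theorem] -/
theorem summable_action_sq (hε : 0 < ε₀) (hW : IsEternalVisc ε₀ νh α W) (hc : IsCancellingCoeff α)
    {C : ℝ} (hC : ∀ k σ, ‖W k σ‖ ≤ C)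
    (hθ : (bigLam ε₀ - (bigLam ε₀)⁻¹) * fluxConst α * C < 1) :
    Summable (fun n : ℤ => ∫ σ, ‖W n σ‖ ^ 2) := by
  obtain ⟨K, hK⟩ := block_sum_le_const hε hW hc hC hθ
  have hJ0 : ∀ n : ℤ, 0 ≤ ∫ σ, ‖W n σ‖ ^ 2 := fun n => integral_nonneg fun σ => by positivity
  refine summable_of_sum_le hJ0 (c := K) fun s => ?_
  rcases s.eq_empty_or_nonempty with hs | hs
  · rw [hs, Finset.sum_empty]
    simpa using hK 0 0
  · set a := s.min' hs with ha
    set b := s.max' hs with hb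
    set N : ℕ := (b - a).toNat + 1 with hN
    have hsub : s ⊆ (Finset.range N).image (fun k : ℕ => a + (k : ℤ)) := by
      intro n hn
      rw [Finset.mem_image]
      have h1 : a ≤ n := Finset.min'_le s n hn
      have h2 : n ≤ b := Finset.le_max' s n hn
      refine ⟨(n - a).toNat, ?_, ?_⟩
      · rw [Finset.mem_range, hN]
        have : (n - a).toNat ≤ (b - a).toNat := Int.toNat_le_toNat (by linarith)
        omega
      · rw [Int.toNat_of_nonneg (by linarith)]; ring
    have hinj : Set.InjOn (fun k : ℕ => a + (k : ℤ)) (Finset.range N : Set ℕ) := by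
      intro x _ y _ hxy
      have : (x : ℤ) = y := by simpa using hxy
      exact_mod_cast this
    calc ∑ n ∈ s, ∫ σ, ‖W n σ‖ ^ 2
        ≤ ∑ n ∈ (Finset.range N).image (fun k : ℕ => a + (k : ℤ)), ∫ σ, ‖W n σ‖ ^ 2 :=
          Finset.sum_le_sum_of_subset_of_nonneg hsub fun n _ _ => hJ0 n
      _ = ∑ k ∈ Finset.range N, ∫ σ, ‖W (a + k) σ‖ ^ 2 := Finset.sum_image hinj
      _ ≤ K := hK a N

/-- The action-fluxes are summable too: `|I_n| ≤ fluxConst α·C·∫‖W_n‖²`.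
[cite: Tao2016AveragedNS, §4 Lemma 4.1 (4.9); cell lemma] -/
theorem summable_flux (hε : 0 < ε₀) (hW : IsEternalVisc ε₀ νh α W) (hc : IsCancellingCoeff α)
    {C : ℝ} (hC : ∀ k σ, ‖W k σ‖ ≤ C)
    (hθ : (bigLam ε₀ - (bigLam ε₀)⁻¹) * fluxConst α * C < 1) :
    Summable (fun n : ℤ => ∫ σ, ⟪W (n + 1) σ, tableA α (W n σ)⟫) := by
  refine Summable.of_norm_bounded ((summable_action_sq hε hW hc hC hθ).mul_left (fluxConst α * C))
    fun n => ?_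
  rw [Real.norm_eq_abs]
  exact abs_integral_flux_le_visc hW hc hC n

/-- **Sharp gap theorem.**  A uniformly bounded admissible eternal solution (any covariant viscosity
`ν̂ ≥ 0`) of a cancelling table at scale ratio `1+ε₀`, `ε₀ > 0`, whose uniform bound `C` satisfies
`(Λ − Λ⁻¹)·fluxConst α·C < 1`, vanishes identically: summing the shell balance over all of `ℤ`,
`Σ' J ≤ (Λ − Λ⁻¹)·Σ' I ≤ (Λ − Λ⁻¹)·fluxConst α·C·Σ' J`.
[cite: Tao2016AveragedNS, §4 (4.1)–(4.3), Lemma 4.1 (4.8)–(4.10), viscous equation before Thm. 4.2, §6.4; cell theorem] -/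
theorem eq_zero_of_small_bound_sharp (hε : 0 < ε₀) (hW : IsEternalVisc ε₀ νh α W)
    (hc : IsCancellingCoeff α) {C : ℝ} (hC : ∀ k σ, ‖W k σ‖ ≤ C)
    (hθ : (bigLam ε₀ - (bigLam ε₀)⁻¹) * fluxConst α * C < 1) :
    ∀ (n : ℤ) (σ : ℝ), W n σ = 0 := by
  set I : ℤ → ℝ := fun n => ∫ σ, ⟪W (n + 1) σ, tableA α (W n σ)⟫ with hI
  set J : ℤ → ℝ := fun n => ∫ σ, ‖W n σ‖ ^ 2 with hJ
  have hΛ1 : 1 ≤ bigLam ε₀ := one_le_bigLam hε.le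
  have hnn : 0 ≤ bigLam ε₀ - (bigLam ε₀)⁻¹ := by
    have : (bigLam ε₀)⁻¹ ≤ 1 := inv_le_one_of_one_le₀ hΛ1
    linarith
  have hJ0 : ∀ n, 0 ≤ J n := fun n => integral_nonneg fun σ => by positivity
  have hJs : Summable J := summable_action_sq hε hW hc hC hθ
  have hIs : Summable I := summable_flux hε hW hc hC hθ
  have hIJ : ∀ n : ℤ, |I n| ≤ fluxConst α * C * J n := fun n => abs_integral_flux_le_visc hW hc hC n
  have hbal : ∀ n : ℤ, J n ≤ bigLam ε₀ * I (n - 1) - (bigLam ε₀)⁻¹ * I n := by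
    intro n
    have h := integral_norm_sq_le hε hW hc hC n
    simp only [hI, hJ, sub_add_cancel]
    exact h
  -- shift invariance of the sum of the fluxes
  have hIs' : Summable (fun n : ℤ => I (n - 1)) :=
    (Equiv.subRight (1 : ℤ)).summable_iff.2 hIs
  have hshift : ∑' n : ℤ, I (n - 1) = ∑' n : ℤ, I n := (Equiv.subRight (1 : ℤ)).tsum_eq I
  -- sum the shell balance over `ℤ`
  have h1 : ∑' n, J n ≤ ∑' n, (bigLam ε₀ * I (n - 1) - (bigLam ε₀)⁻¹ * I n) :=
    Summable.tsum_le_tsum hbal hJs ((hIs'.mul_left _).sub (hIs.mul_left _))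
  have h2 : ∑' n : ℤ, (bigLam ε₀ * I (n - 1) - (bigLam ε₀)⁻¹ * I n)
      = (bigLam ε₀ - (bigLam ε₀)⁻¹) * ∑' n, I n := by
    rw [Summable.tsum_sub (hIs'.mul_left _) (hIs.mul_left _), tsum_mul_left, tsum_mul_left, hshift]
    ring
  have h3 : |∑' n, I n| ≤ fluxConst α * C * ∑' n, J n := by
    have hab : Summable (fun n => |I n|) := hIs.abs
    calc |∑' n, I n| ≤ ∑' n, |I n| := by
          have := norm_tsum_le_tsum_norm hIs.norm
          simpa only [Real.norm_eq_abs] using this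
      _ ≤ ∑' n, fluxConst α * C * J n := Summable.tsum_le_tsum hIJ hab (hJs.mul_left _)
      _ = fluxConst α * C * ∑' n, J n := tsum_mul_left
  have hT0 : 0 ≤ ∑' n, J n := tsum_nonneg hJ0
  have h4 : ∑' n, J n ≤ (bigLam ε₀ - (bigLam ε₀)⁻¹) * fluxConst α * C * ∑' n, J n := by
    calc ∑' n, J n ≤ (bigLam ε₀ - (bigLam ε₀)⁻¹) * ∑' n, I n := by rw [← h2]; exact h1
      _ ≤ (bigLam ε₀ - (bigLam ε₀)⁻¹) * |∑' n, I n| :=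
          mul_le_mul_of_nonneg_left (le_abs_self _) hnn
      _ ≤ (bigLam ε₀ - (bigLam ε₀)⁻¹) * (fluxConst α * C * ∑' n, J n) :=
          mul_le_mul_of_nonneg_left h3 hnn
      _ = (bigLam ε₀ - (bigLam ε₀)⁻¹) * fluxConst α * C * ∑' n, J n := by ring
  have hTzero : ∑' n, J n = 0 := by
    by_contra hne
    have hpos : 0 < ∑' n, J n := lt_of_le_of_ne hT0 (Ne.symm hne)
    have : (bigLam ε₀ - (bigLam ε₀)⁻¹) * fluxConst α * C * ∑' n, J n < 1 * ∑' n, J n :=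
      mul_lt_mul_of_pos_right hθ hpos
    linarith
  have hJzero : ∀ n, J n = 0 := by
    intro n
    have h := hJs.le_tsum n (fun k _ => hJ0 k)
    rw [hTzero] at h
    exact le_antisymm h (hJ0 n)
  intro n σ
  have hE := integrable_norm_sq_visc hW hC n
  have hae : (fun σ => ‖W n σ‖ ^ 2) =ᵐ[volume] 0 :=
    (integral_eq_zero_iff_of_nonneg (fun σ => by positivity) hE).1 (hJzero n)
  have hcont : Continuous (fun σ => ‖W n σ‖ ^ 2) :=
    ((WakeRatchetOrthant.continuous_shell hW n).norm).pow 2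
  have hzero := congrFun ((Continuous.ae_eq_iff_eq volume hcont continuous_const).1 hae) σ
  have h0 : ‖W n σ‖ ^ 2 = 0 := hzero
  exact norm_eq_zero.1 ((pow_eq_zero_iff two_ne_zero).1 h0)

/-- **The sharp floor on comparable tables.**  On a cancelling `R`-comparable table (`m = 4`) at scale
ratio `1+ε₀`, `0 < ε₀ ≤ 1`, every non-trivial uniformly bounded admissible eternal solution with any
covariant viscosity `ν̂ ≥ 0` has a shell value of norm `> 1/(896 ε₀)` — its type-I constant diverges like
`ε₀⁻¹` as the scale ratio becomes fine; no self-similarity is assumed.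
[cite: Tao2016AveragedNS, §4 (4.1)–(4.3), §6.1, §6.4; cell theorem] -/
theorem eternal_exists_large {ε₀ νh R : ℝ} {α : Fin 4 → Fin 4 → Fin 4 → ℤ × ℤ × ℤ → ℝ}
    {W : ℤ → ℝ → Em 4} (hε : 0 < ε₀) (hε1 : ε₀ ≤ 1) (hc : IsCancellingCoeff α)
    (hα : IsComparableCoeff R α) (hW : IsEternalVisc ε₀ νh α W) (hne : ∃ n σ, W n σ ≠ 0) :
    ∃ (n : ℤ) (σ : ℝ), 1 / (896 * ε₀) < ‖W n σ‖ := by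
  by_contra h
  push Not at h
  have h14 := WakeRatchetDSSAmplitudeFloor.bigLam_sub_inv_lt hε hε1
  have h64 := WakeRatchetDSSAmplitudeFloor.fluxConst_le_64 hα
  have hf0 : 0 ≤ fluxConst α := (table_sTable α hc).CA_nonneg
  have hq : 0 < 1 / (896 * ε₀) := by positivity
  have hlt : (bigLam ε₀ - (bigLam ε₀)⁻¹) * fluxConst α * (1 / (896 * ε₀)) < 1 := by
    calc (bigLam ε₀ - (bigLam ε₀)⁻¹) * fluxConst α * (1 / (896 * ε₀))
        ≤ |bigLam ε₀ - (bigLam ε₀)⁻¹| * fluxConst α * (1 / (896 * ε₀)) :=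
          mul_le_mul_of_nonneg_right (mul_le_mul_of_nonneg_right (le_abs_self _) hf0) hq.le
      _ ≤ |bigLam ε₀ - (bigLam ε₀)⁻¹| * 64 * (1 / (896 * ε₀)) :=
          mul_le_mul_of_nonneg_right (mul_le_mul_of_nonneg_left h64 (abs_nonneg _)) hq.le
      _ < 14 * ε₀ * 64 * (1 / (896 * ε₀)) :=
          mul_lt_mul_of_pos_right (mul_lt_mul_of_pos_right h14 (by norm_num)) hq
      _ = 1 := by field_simp; ring
  obtain ⟨n, σ, hnz⟩ := hne
  exact hnz (eq_zero_of_small_bound_sharp hε hW hc h hlt n σ)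

/-- **The floor in the crux's own vocabulary.**  For `InTableClass R α`, `0 < ε₀ ≤ 1`, any `ν̂`:
every admissible eternal solution in the scope of `WakeRatchet.TailRatchet` (`IsEternalVisc ε₀ ν̂ α W`;
`UniformBound W` is implied by the negation of the conclusion) is identically zero or has a shell value
of norm `> 1/(896 ε₀)`. [cite: Tao2016AveragedNS, §4 (4.1)–(4.3), §6.1, §6.4; cell theorem] -/
theorem tailRatchet_scope_floor {ε₀ νh R : ℝ} {α : Fin 4 → Fin 4 → Fin 4 → ℤ × ℤ × ℤ → ℝ}
    {W : ℤ → ℝ → Em 4} (hε : 0 < ε₀) (hε1 : ε₀ ≤ 1) (hα : InTableClass R α)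
    (hW : IsEternalVisc ε₀ νh α W) (hne : ∃ n σ, W n σ ≠ 0) :
    ∃ (n : ℤ) (σ : ℝ), 1 / (896 * ε₀) < ‖W n σ‖ :=
  eternal_exists_large hε hε1 hα.2.1 hα.2.2 hW hne

end WakeRatchetEternalFloor

end Summit.NavierStokesRegularity.NavierStokesRegularity.Theorems

end
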